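import Mathlib
import HarnessLib.Audit
import Summits.PneNP.PneNP.Theorems.PstarQuadRank

/-!
# Rank rigidity: a degree-two function vanishing on `Z(q)` is `0` or `q` (ROUND-24, GAPTWO-PLAN v1 S4b (b5) / memo §9 O4 = R4)

FRONTIER range-avoidance ladder, rung F-N3, ROUND 24 (cell `pnp-ideate`, planner memo `r24/CORE-BOUND-NOTES.md` §4 rank-`≥ 4` rigidity,
§9 R4/O4 "the one genuinely algebraic lemma of the line"; restricted-model proof complexity — nothing here bears on `P` versus `NP`).

Let `q, g` be quadratic functions on a finite `𝔽₂`-module `M` (`PstarCubeIdeals.IsQuadFn`; polar form `B` of `q`, radical `rad B`,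
`PstarQuadRank`) with `g = 0` on `Z(q) = {q = 0}`.  Then **`g = 0` or `g = q`** in each of the following cases — together they cover every
`q` of rank `≥ 4` EXCEPT the pure elliptic rank-`4` shape `xy + zw + 1`, whose degree-`2` ideal really is larger (`(x+y)(z+w)`, memo §4):

* `eq_zero_or_eq_of_translation` — `q` has a TRANSLATION DIRECTION `r` (`q (x + r) = q x + 1`; = the balanced types, e.g. `xy + zw + u`)
  and rank `≥ 3` (`dim rad B + 3 ≤ dim M`): by the master identity `g = q · ∂_r g` (`PstarCubeIdeals`, with `λ := q`!) and the CUBIC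
  OBSTRUCTION (`q · m` quadratic with `m` affine non-constant forces rank `≤ 2`);
* `eq_zero_or_eq_of_bias_pos` — `q` has POSITIVE BIAS (more zeros than ones: the hyperbolic types `xy + zw (+ …)`, any rank `≥ 2`): the
  supports of `g` and `q + g` split that of `q` (`bias q + |M| = bias g + bias (q+g)`) while each piece has bias `≤ |M|/2`;
* `eq_zero_or_eq_of_rank_six` — `q` has RANK `≥ 6` (`dim rad B + 6 ≤ dim M`), any type: the same splitting with the second-moment bounds
  `bias² ≤ 2^{dim M + dim rad}` (`PstarQuadBias.bias_sq_le`) and subadditivity of radicals — two pieces of bias `≥ 3|M|/8` each would need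
  `dim rad g + dim rad (q+g) > dim M + dim rad q`.

No normal forms are used (the memo's suggested route); everything is coordinate-free.
-/

set_option linter.dupNamespace false -- `Summit.PneNP.PneNP.…`: summit = sub-problem name (D-0017 single-conjunct layout)

open Finset Module
open Summit.PneNP.PneNP.Theorems.PstarQuadBias (chi)
open Summit.PneNP.PneNP.Theorems.PstarCubeIdeals (deriv IsAffineFn IsQuadFn deriv_apply isAffineFn_deriv eq_mul_deriv_of_hyperplane
  flips_of_affine)
open Summit.PneNP.PneNP.Theorems.PstarQuadRank

namespace Summit.PneNP.PneNP.Theorems.PstarRankRigidity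

/-- Every element of `𝔽₂` is `0` or `1`. -/
private theorem zmod2_cases (t : ZMod 2) : t = 0 ∨ t = 1 := by
  revert t; decide

/-- In `𝔽₂`, `t ≠ 0 ↔ t = 1`. -/
private theorem zmod2_eq_one_of_ne_zero {t : ZMod 2} (h : t ≠ 0) : t = 1 := by
  revert t h; decide

/-- In `𝔽₂`, `x + x = 0`. -/
private theorem zmod2_add_self (x : ZMod 2) : x + x = 0 := by
  revert x; decide

variable {M : Type*} [AddCommGroup M] [Module (ZMod 2) M] [Fintype M] [DecidableEq M]
  {q g : M → ZMod 2} {B : LinearMap.BilinForm (ZMod 2) M}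

/-! ## The translation case -/

omit [DecidableEq M] in
/-- **Rank rigidity, translation type.**  If `q (x + r) = q x + 1` for some `r`, the polar form of `q` has rank `≥ 3`
(`dim rad B + 3 ≤ dim M`), and the quadratic `g` vanishes on `Z(q)`, then `g = 0` or `g = q`. -/
theorem eq_zero_or_eq_of_translation (hB : ∀ x w, q (x + w) = q x + q w + q 0 + B x w) {r : M} (hr : ∀ x, q (x + r) = q x + 1)
    (hrank : finrank (ZMod 2) (rad B) + 3 ≤ finrank (ZMod 2) M) (hg : IsQuadFn g) (hZ : ∀ x, q x = 0 → g x = 0) :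
    (∀ x, g x = 0) ∨ (∀ x, g x = q x) := by
  -- the master identity with `λ := q` itself: `g = q · ∂_r g`
  have hmul : ∀ x, g x = q x * deriv g r x := eq_mul_deriv_of_hyperplane (lam := q) hr hZ
  have hm : IsAffineFn (deriv g r) := isAffineFn_deriv hg r
  by_cases hconst : ∀ x, deriv g r x = deriv g r 0
  · rcases zmod2_cases (deriv g r 0) with h0 | h0
    · left; intro x; rw [hmul x, hconst x, h0, mul_zero]
    · right; intro x; rw [hmul x, hconst x, h0, mul_one]
  · -- a non-constant multiplier contradicts the rank through the cubic obstruction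
    exfalso
    push Not at hconst
    obtain ⟨c, hc⟩ := hconst
    have hc1 : deriv g r c + deriv g r 0 = 1 := by
      rcases zmod2_cases (deriv g r c) with e | e <;> rcases zmod2_cases (deriv g r 0) with e' | e' <;> rw [e, e'] at hc ⊢ <;>
        first | exact absurd rfl hc | decide
    have hqm : IsQuadFn (fun x => q x * deriv g r x) := by
      have : (fun x => q x * deriv g r x) = g := funext fun x => (hmul x).symm
      rw [this]; exact hg
    have h := finrank_le_rad_add_two_of_cubic hB hm hqm hc1
    omega

/-! ## Bias bookkeeping shared by the two counting cases -/

omit [Fintype M] [DecidableEq M] in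
/-- `B + B = 0` for bilinear forms over `𝔽₂`. -/
private theorem bilin_add_self (C : LinearMap.BilinForm (ZMod 2) M) : C + C = 0 := by
  ext x y; simp only [LinearMap.add_apply, LinearMap.zero_apply]; exact zmod2_add_self _

omit [DecidableEq M] in
/-- A quadratic function that takes both values has `2 · bias ≤ |M|`. -/
theorem two_mul_bias_le {f : M → ZMod 2} {C : LinearMap.BilinForm (ZMod 2) M} (hC : ∀ x w, f (x + w) = f x + f w + f 0 + C x w)
    {v : M} (hv : f v ≠ f 0) : 2 * bias f ≤ 2 ^ finrank (ZMod 2) M := by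
  classical
  by_cases hC0 : ∀ a b, C a b = 0
  · rw [bias_eq_zero_of_affine (isAffineFn_of_polar_zero hC hC0) hv, mul_zero]; positivity
  · push Not at hC0
    obtain ⟨a, b, hab⟩ := hC0
    exact (mul_le_mul_of_nonneg_left (le_abs_self (bias f)) (by norm_num)).trans (two_mul_abs_bias_le hC hab)

omit [Fintype M] [DecidableEq M] in
/-- The polar identity of `q + g`. -/
private theorem hsum_form (hB : ∀ x w, q (x + w) = q x + q w + q 0 + B x w) {C : LinearMap.BilinForm (ZMod 2) M}
    (hC : ∀ x w, g (x + w) = g x + g w + g 0 + C x w) :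
    ∀ x w, (fun x => q x + g x) (x + w) = (fun x => q x + g x) x + (fun x => q x + g x) w + (fun x => q x + g x) 0 + (B + C) x w := by
  intro x w
  simp only [LinearMap.add_apply]
  rw [hB, hC]; ring

omit [Module (ZMod 2) M] [Fintype M] [DecidableEq M] in
/-- If `g` is neither `0` nor `q` (and vanishes on `Z(q)`, with `q` non-constant), then `g` and `q + g` both take both values. -/
private theorem both_values (hZ : ∀ x, q x = 0 → g x = 0) {x₀ : M} (hx₀ : q x₀ = 0) (h1 : ¬ ∀ x, g x = 0) (h2 : ¬ ∀ x, g x = q x) :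
    (∃ v, g v ≠ g 0) ∧ (∃ v, (fun x => q x + g x) v ≠ (fun x => q x + g x) 0) := by
  push Not at h1 h2
  obtain ⟨x₁, hx₁⟩ := h1
  obtain ⟨x₂, hx₂⟩ := h2
  have hg₀ : g x₀ = 0 := hZ x₀ hx₀
  refine ⟨?_, ?_⟩
  · by_cases h : g 0 = 0
    · exact ⟨x₁, by rw [h]; exact hx₁⟩
    · exact ⟨x₀, by rw [hg₀]; exact Ne.symm h⟩
  · have e₀ : q x₀ + g x₀ = 0 := by rw [hx₀, hg₀, add_zero]
    have e₂ : q x₂ + g x₂ ≠ 0 := by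
      intro e; apply hx₂
      rcases zmod2_cases (q x₂) with a | a <;> rcases zmod2_cases (g x₂) with b | b <;> rw [a, b] at e ⊢ <;>
        first | rfl | exact absurd e (by decide)
    by_cases h : q 0 + g 0 = 0
    · exact ⟨x₂, by show q x₂ + g x₂ ≠ q 0 + g 0; rw [h]; exact e₂⟩
    · exact ⟨x₀, by show q x₀ + g x₀ ≠ q 0 + g 0; rw [e₀]; exact Ne.symm h⟩

omit [Fintype M] [DecidableEq M] in
/-- `Z(q)` is non-empty unless `q ≡ 1`, in which case the polar form vanishes. -/
private theorem exists_zero_of_polar_ne (hB : ∀ x w, q (x + w) = q x + q w + q 0 + B x w) {a b : M} (hab : B a b ≠ 0) :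
    ∃ x₀, q x₀ = 0 := by
  by_contra hno
  push Not at hno
  have hone : ∀ x, q x = q 0 := fun x => by rw [zmod2_eq_one_of_ne_zero (hno x), zmod2_eq_one_of_ne_zero (hno 0)]
  exact hab (polar_eq_zero_of_const hB hone a b)

/-! ## The positive-bias case -/

omit [DecidableEq M] in
/-- **Rank rigidity, positive bias.**  If `q` has more zeros than ones (`bias q > 0`) and a non-zero polar form, then a quadratic `g`
vanishing on `Z(q)` is `0` or `q`. -/
theorem eq_zero_or_eq_of_bias_pos (hB : ∀ x w, q (x + w) = q x + q w + q 0 + B x w) {a b : M} (hab : B a b ≠ 0) (hpos : 0 < bias q)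
    (hg : IsQuadFn g) (hZ : ∀ x, q x = 0 → g x = 0) : (∀ x, g x = 0) ∨ (∀ x, g x = q x) := by
  by_contra h
  push Not at h
  obtain ⟨h1, h2⟩ := h
  obtain ⟨x₀, hx₀⟩ := exists_zero_of_polar_ne hB hab
  obtain ⟨⟨v, hv⟩, ⟨v', hv'⟩⟩ := both_values hZ hx₀ (by simpa using h1) (by simpa using h2)
  obtain ⟨C, hC⟩ := hg
  have e := bias_add_card_eq (M := M) hZ
  have b1 := two_mul_bias_le hC hv
  have b2 := two_mul_bias_le (f := fun x => q x + g x) (hsum_form hB hC) hv'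
  linarith

/-! ## The rank-six case -/

/-- **Rank rigidity, rank at least six.**  If the polar form of `q` has radical of codimension `≥ 6`, then a quadratic `g` vanishing on
`Z(q)` is `0` or `q`. -/
theorem eq_zero_or_eq_of_rank_six (hB : ∀ x w, q (x + w) = q x + q w + q 0 + B x w)
    (hrank : finrank (ZMod 2) (rad B) + 6 ≤ finrank (ZMod 2) M) (hg : IsQuadFn g) (hZ : ∀ x, q x = 0 → g x = 0) :
    (∀ x, g x = 0) ∨ (∀ x, g x = q x) := by
  classical
  by_contra h
  push Not at h
  obtain ⟨h1, h2⟩ := h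
  -- `q` has a zero (else `B = 0` and the radical is everything)
  have hab : ∃ a b, B a b ≠ 0 := by
    by_contra hno
    push Not at hno
    have htop : rad B = ⊤ := by
      rw [eq_top_iff]; intro x _; rw [mem_rad]; exact hno x
    rw [htop, finrank_top] at hrank
    omega
  obtain ⟨a, b, hab⟩ := hab
  obtain ⟨x₀, hx₀⟩ := exists_zero_of_polar_ne hB hab
  obtain ⟨⟨v, hv⟩, ⟨v', hv'⟩⟩ := both_values hZ hx₀ (by simpa using h1) (by simpa using h2)
  obtain ⟨C, hC⟩ := hg
  have hC' := hsum_form hB hC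
  -- notation
  set V := finrank (ZMod 2) M with hV
  set d := finrank (ZMod 2) (rad B) with hd
  set dg := finrank (ZMod 2) (rad C) with hdg
  set dg' := finrank (ZMod 2) (rad (B + C)) with hdg'
  obtain ⟨k, hk⟩ : ∃ k, V = k + 6 := ⟨V - 6, by omega⟩
  set P : ℤ := 2 ^ k with hP
  have hP1 : 1 ≤ P := one_le_pow₀ (by norm_num)
  have e64 : (2 : ℤ) ^ V = 64 * P := by rw [hk, pow_add, hP]; ring
  -- the bias identities and bounds
  have e := bias_add_card_eq (M := M) hZ
  have b1 := two_mul_bias_le hC hv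
  have b2 := two_mul_bias_le (f := fun x => q x + g x) hC' hv'
  have sq := bias_sq_le_pow (M := M) hB
  have sg := bias_sq_le_pow (M := M) hC
  have sg' := bias_sq_le_pow (M := M) (f := fun x => q x + g x) hC'
  -- radical subadditivity: `dg + dg' ≤ V + d` (note `C + (B + C) = B`)
  have hsub : dg + dg' ≤ V + d := by
    have h := finrank_rad_add_le (M := M) C (B + C)
    have hBC : C + (B + C) = B := by rw [← add_assoc, add_comm C B, add_assoc, bilin_add_self, add_zero]
    rw [hBC] at h
    exact h
  rw [← hV] at e b1 b2 sq sg sg'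
  -- `|bias q| ≤ 8P`
  have hq8 : -(8 * P) ≤ bias q := by
    have h1' : bias q ^ 2 ≤ (8 * P) ^ 2 := by
      calc bias q ^ 2 ≤ 2 ^ (V + d) := sq
        _ ≤ 2 ^ (2 * k + 6) := pow_le_pow_right₀ (by norm_num) (by omega)
        _ = (8 * P) ^ 2 := by rw [hP]; ring
    have := abs_le_of_sq_le_sq' h1' (by positivity)
    linarith [this.1]
  -- each piece has bias at least `24P`
  have hg24 : 24 * P ≤ bias g := by linarith
  have hg'24 : 24 * P ≤ bias (fun x => q x + g x) := by linarith
  -- but the product of the biases is at most `512 P²`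
  have hprod : (bias g * bias (fun x => q x + g x)) ^ 2 ≤ (512 * P ^ 2) ^ 2 := by
    have hm := mul_le_mul sg sg' (sq_nonneg _) (by positivity)
    rw [← mul_pow, ← pow_add] at hm
    calc (bias g * bias (fun x => q x + g x)) ^ 2 ≤ 2 ^ (V + dg + (V + dg')) := hm
      _ ≤ 2 ^ (4 * k + 18) := pow_le_pow_right₀ (by norm_num) (by omega)
      _ = (512 * P ^ 2) ^ 2 := by rw [hP]; ring
  have hprod' : bias g * bias (fun x => q x + g x) ≤ 512 * P ^ 2 :=
    (pow_le_pow_iff_left₀ (by nlinarith) (by positivity) two_ne_zero).1 hprod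
  have hlow : 24 * P * (24 * P) ≤ bias g * bias (fun x => q x + g x) :=
    mul_le_mul hg24 hg'24 (by positivity) (by linarith)
  nlinarith

end Summit.PneNP.PneNP.Theorems.PstarRankRigidity
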